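import Mathlib.RingTheory.FormalGroup.Basic
import HarnessLib

/-!
# Homomorphisms of one-dimensional formal group laws
# ([Hazewinkel 1978] §1.2; [Silverman 2009] Ch. IV §2)

Topic `Literature/RingTheory/FormalGroups`; namespace `Literature.RingTheory.FormalGroups`.  DEFINITIONS + fully proved
theorems; no named fact, no instance, no notation, no `sorry`.  Cell `hodgecm-mathlib`, P6 «MOD programme» ROW 4B
(BT groups & Serre–Tate ∕ Lubin–Tate), base layer of letter L4B.3 (MOD-PLAN v0.9 §4; P6 kit author A-p07 (g17)).

The CARRIER is Mathlib's `FormalGroup R` (`Mathlib.RingTheory.FormalGroup.Basic`, W. Zou 2026): a one-dimensional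
formal group law `F(X,Y) ∈ R⟦X,Y⟧` (`F.toPowerSeries : MvPowerSeries (Fin 2) R`, `F ≡ X + Y mod deg 2`, associative;
`F.IsComm` for commutative laws; unit laws `F.add_zero` ∕ `F.zero_add`; `F.assoc'`, `F.comm'` in every currency;
`F.Point σ`; `𝔾ₐ`, `𝔾ₘ`; base change `F.map`).  Mathlib has NO homomorphisms of formal group laws; this file adds them
WITHOUT restating anything of the carrier (cell B-p18 (g34) search-before-state finding, 2026-09-01).

## Contents

* `FormalGroupHom F G` — homomorphisms `φ : F → G` of formal group laws over `R`: a power series `φ(T) ∈ R⟦T⟧`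
  with `φ(0) = 0` and `φ(F(X,Y)) = G(φ(X), φ(Y))` ([Hazewinkel1978] §1.2 Def. (1.2.1); [SilvermanAEC2009] IV Def. 2.2).
* `map_add'` — the defining identity in every currency: `φ(F(f,g)) = G(φ(f), φ(g))` for all substitutable `f`, `g`.
* `FormalGroupHom.id`, `FormalGroupHom.comp` (proved to be homomorphisms), `ext`, `comp_id`, `id_comp`, `comp_assoc`;
  the zero homomorphism `FormalGroupHom.zero` (`φ = 0`), `comp_zero`, `zero_comp`.
* base change `FormalGroupHom.map (f : R →+* S) : FormalGroupHom F G → FormalGroupHom (F.map f) (G.map f)`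
  ([Hazewinkel1978] (1.1.6) `f_* φ`).
* points: `FormalGroupHom.pointMap φ : F.Point σ →+ G.Point σ`, `x ↦ φ(x)` (an additive monoid homomorphism for
  Mathlib's `AddMonoid (F.Point σ)`).

Deliberately NOT here: the sum of homomorphisms into a commutative law and the distributive laws (sibling
`FormalGroupHomAdd`), the inverse series `ι(X)` (`F(X, ι(X)) = 0`), `[n]`-series and heights, formal `𝒪`-modules,
Lubin–Tate series.
-/

noncomputable section

namespace Literature.RingTheory.FormalGroups

open _root_.MvPowerSeries (HasSubst subst)

universe u v

variable {R : Type u} [CommRing R] {S : Type v} [CommRing S]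

/-! ## §0 Substitution bookkeeping -/

/-- A pair of substitutable power series is a substitutable family (Bourbaki's condition, finite index set).
[cite: BourbakiAlgebraII2003, Ch. IV §4 no. 3] -/
theorem hasSubst_pair {τ : Type*} {f g : MvPowerSeries τ R}
    (hf : PowerSeries.HasSubst f) (hg : PowerSeries.HasSubst g) : HasSubst ![f, g] :=
  MvPowerSeries.hasSubst_of_constantCoeff_nilpotent fun s => by
    fin_cases s
    · simpa using hf
    · simpa using hg

/-- Associativity of substitution, mixed currencies: a univariate substitution followed by a multivariate one,
`(φ(a))(b) = φ(a(b))`. [cite: BourbakiAlgebraII2003, Ch. IV §4 no. 3] -/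
theorem subst_powerSeries_subst {τ υ : Type*} {a : MvPowerSeries τ R} (ha : PowerSeries.HasSubst a)
    {b : τ → MvPowerSeries υ R} (hb : HasSubst b) (φ : PowerSeries R) :
    subst b (PowerSeries.subst a φ) = PowerSeries.subst (subst b a) φ := by
  rw [PowerSeries.subst_def, PowerSeries.subst_def]
  exact MvPowerSeries.subst_comp_subst_apply ha.const hb φ

/-- Substituting a pair into `![X 0, X 1]`-shaped data: `(![u, v] ∘ ·)` after substitution (private plumbing). [folklore] -/
private theorem subst_vec2 {τ υ : Type*} (b : τ → MvPowerSeries υ R) (u v : MvPowerSeries τ R) :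
    (fun s => subst b ((![u, v] : Fin 2 → MvPowerSeries τ R) s)) = ![subst b u, subst b v] := by
  funext s; fin_cases s <;> simp

/-- `F(f,g)` is substitutable when `f`, `g` are (its constant coefficient is nilpotent, indeed `F(0,0) = 0`).
[cite: Hazewinkel1978, §1.1 Def. (1.1.1)] -/
theorem hasSubst_formalGroup_subst (F : FormalGroup R) {τ : Type*} {f g : MvPowerSeries τ R}
    (hf : PowerSeries.HasSubst f) (hg : PowerSeries.HasSubst g) :
    PowerSeries.HasSubst (F.toPowerSeries.subst ![f, g]) :=
  MvPowerSeries.IsNilpotent_subst (hasSubst_pair hf hg) (F.zero_constantCoeff ▸ IsNilpotent.zero)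

/-- `F` itself is substitutable as a univariate argument (`φ(F(X,Y))` makes sense). [cite: Hazewinkel1978, §1.1 Def. (1.1.1)] -/
theorem hasSubst_formalGroup (F : FormalGroup R) : PowerSeries.HasSubst F.toPowerSeries :=
  PowerSeries.HasSubst.of_constantCoeff_zero F.zero_constantCoeff

/-! ## §1 Homomorphisms -/

/-- A **homomorphism of one-dimensional formal group laws** `φ : F → G` over `R`: a power series `φ(T) ∈ R⟦T⟧` with
`φ(0) = 0` and `φ(F(X,Y)) = G(φ(X), φ(Y))` in `R⟦X,Y⟧`. [cite: Hazewinkel1978, §1.2 Def. (1.2.1)] -/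
structure FormalGroupHom (F G : FormalGroup R) where
  /-- The series `φ(T)`. -/
  toPowerSeries : PowerSeries R
  /-- `φ(0) = 0`. -/
  constantCoeff_eq_zero : PowerSeries.constantCoeff toPowerSeries = 0
  /-- `φ(F(X,Y)) = G(φ(X), φ(Y))`. -/
  map_add : PowerSeries.subst F.toPowerSeries toPowerSeries =
    G.toPowerSeries.subst ![PowerSeries.subst (MvPowerSeries.X 0 : MvPowerSeries (Fin 2) R) toPowerSeries,
      PowerSeries.subst (MvPowerSeries.X 1 : MvPowerSeries (Fin 2) R) toPowerSeries]

namespace FormalGroupHom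

variable {F G H : FormalGroup R}

/-- Two homomorphisms with the same series are equal (a homomorphism IS its series). [cite: Hazewinkel1978, §1.2 Def. (1.2.1)] -/
@[ext] theorem ext {φ ψ : FormalGroupHom F G} (h : φ.toPowerSeries = ψ.toPowerSeries) : φ = ψ := by
  cases φ; cases ψ; cases h; rfl

/-- The series of a homomorphism is substitutable (`φ(0) = 0`). [cite: Hazewinkel1978, §1.2 Def. (1.2.1)] -/
theorem hasSubst (φ : FormalGroupHom F G) : PowerSeries.HasSubst φ.toPowerSeries :=
  PowerSeries.HasSubst.of_constantCoeff_zero' φ.constantCoeff_eq_zero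

/-- `φ(f)` is substitutable when `f` is. [cite: Hazewinkel1978, §1.2 Def. (1.2.1)] -/
theorem hasSubst_subst (φ : FormalGroupHom F G) {τ : Type*} {f : MvPowerSeries τ R} (hf : PowerSeries.HasSubst f) :
    PowerSeries.HasSubst (PowerSeries.subst f φ.toPowerSeries) := by
  have h := PowerSeries.HasSubst.comp φ.hasSubst hf
  rwa [PowerSeries.coe_substAlgHom hf] at h

/-- `φ(f)` has vanishing constant coefficient when `f` has. [cite: Hazewinkel1978, §1.2 Def. (1.2.1)] -/
theorem constantCoeff_subst_eq_zero (φ : FormalGroupHom F G) {τ : Type*} {f : MvPowerSeries τ R}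
    (hf : MvPowerSeries.constantCoeff f = 0) : MvPowerSeries.constantCoeff (PowerSeries.subst f φ.toPowerSeries) = 0 :=
  PowerSeries.constantCoeff_subst_eq_zero hf _ φ.constantCoeff_eq_zero

/-- **The homomorphism identity in every currency**: `φ(F(f,g)) = G(φ(f), φ(g))` for all substitutable `f`, `g`.
[cite: Hazewinkel1978, §1.2 Def. (1.2.1)] -/
theorem map_add' (φ : FormalGroupHom F G) {τ : Type*} {f g : MvPowerSeries τ R}
    (hf : PowerSeries.HasSubst f) (hg : PowerSeries.HasSubst g) :
    PowerSeries.subst (F.toPowerSeries.subst ![f, g]) φ.toPowerSeries =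
      G.toPowerSeries.subst ![PowerSeries.subst f φ.toPowerSeries, PowerSeries.subst g φ.toPowerSeries] := by
  have hb : HasSubst ![f, g] := hasSubst_pair hf hg
  have h := congrArg (subst ![f, g]) φ.map_add
  rw [subst_powerSeries_subst (hasSubst_formalGroup F) hb,
    MvPowerSeries.subst_comp_subst_apply (hasSubst_pair (φ.hasSubst_subst (PowerSeries.HasSubst.X 0))
      (φ.hasSubst_subst (PowerSeries.HasSubst.X 1))) hb, subst_vec2 ![f, g],
    subst_powerSeries_subst (PowerSeries.HasSubst.X 0) hb, subst_powerSeries_subst (PowerSeries.HasSubst.X 1) hb,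
    MvPowerSeries.subst_X hb, MvPowerSeries.subst_X hb] at h
  simpa using h

variable (F) in
/-- The **identity homomorphism** `φ(T) = T`. [cite: Hazewinkel1978, §1.2 Def. (1.2.1)] -/
def id : FormalGroupHom F F where
  toPowerSeries := PowerSeries.X
  constantCoeff_eq_zero := PowerSeries.constantCoeff_X
  map_add := by
    have hX : (![MvPowerSeries.X 0, MvPowerSeries.X 1] : Fin 2 → MvPowerSeries (Fin 2) R) = MvPowerSeries.X := by
      funext i; fin_cases i <;> rfl
    rw [PowerSeries.subst_X (hasSubst_formalGroup F), PowerSeries.subst_X (PowerSeries.HasSubst.X 0),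
      PowerSeries.subst_X (PowerSeries.HasSubst.X 1), hX, MvPowerSeries.subst_self]
    rfl

/-- The identity homomorphism is the series `T`. [cite: Hazewinkel1978, §1.2 Def. (1.2.1)] -/
@[simp] theorem id_toPowerSeries : (FormalGroupHom.id F).toPowerSeries = PowerSeries.X := rfl

/-- **Composition of homomorphisms** `(ψ ∘ φ)(T) = ψ(φ(T))`; it is a homomorphism:
`ψ(φ(F(X,Y))) = ψ(G(φX, φY)) = H(ψφX, ψφY)`. [cite: Hazewinkel1978, §1.2 Def. (1.2.1)] -/
def comp (ψ : FormalGroupHom G H) (φ : FormalGroupHom F G) : FormalGroupHom F H where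
  toPowerSeries := PowerSeries.subst φ.toPowerSeries ψ.toPowerSeries
  constantCoeff_eq_zero := ψ.constantCoeff_subst_eq_zero φ.constantCoeff_eq_zero
  map_add := by
    have h0 := φ.hasSubst_subst (PowerSeries.HasSubst.X (0 : Fin 2))
    have h1 := φ.hasSubst_subst (PowerSeries.HasSubst.X (1 : Fin 2))
    rw [PowerSeries.subst_comp_subst_apply φ.hasSubst (hasSubst_formalGroup F), φ.map_add, ψ.map_add' h0 h1,
      PowerSeries.subst_comp_subst_apply φ.hasSubst (PowerSeries.HasSubst.X 0),
      PowerSeries.subst_comp_subst_apply φ.hasSubst (PowerSeries.HasSubst.X 1)]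

/-- The series of a composite is the composite series `ψ(φ(T))`. [cite: Hazewinkel1978, §1.2 Def. (1.2.1)] -/
@[simp] theorem comp_toPowerSeries (ψ : FormalGroupHom G H) (φ : FormalGroupHom F G) :
    (ψ.comp φ).toPowerSeries = PowerSeries.subst φ.toPowerSeries ψ.toPowerSeries := rfl

/-- `φ ∘ id = φ`. [cite: Hazewinkel1978, §1.2 Def. (1.2.1)] -/
theorem comp_id (φ : FormalGroupHom F G) : φ.comp (FormalGroupHom.id F) = φ := by
  ext1; simp

/-- `id ∘ φ = φ`. [cite: Hazewinkel1978, §1.2 Def. (1.2.1)] -/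
theorem id_comp (φ : FormalGroupHom F G) : (FormalGroupHom.id G).comp φ = φ := by
  ext1
  simp only [comp_toPowerSeries, id_toPowerSeries]
  exact PowerSeries.subst_X φ.hasSubst

/-- Composition of homomorphisms is associative (associativity of substitution).
[cite: Hazewinkel1978, §1.2 Def. (1.2.1)] [cite: BourbakiAlgebraII2003, Ch. IV §4 no. 3] -/
theorem comp_assoc {K : FormalGroup R} (χ : FormalGroupHom H K) (ψ : FormalGroupHom G H) (φ : FormalGroupHom F G) :
    (χ.comp ψ).comp φ = χ.comp (ψ.comp φ) := by
  ext1
  simp only [comp_toPowerSeries]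
  rw [PowerSeries.subst_comp_subst_apply ψ.hasSubst φ.hasSubst]

variable (F G) in
/-- The **zero homomorphism** `φ(T) = 0` (`0 = G(0,0)`). [cite: Hazewinkel1978, §1.2 Def. (1.2.1)] -/
def zero : FormalGroupHom F G where
  toPowerSeries := 0
  constantCoeff_eq_zero := map_zero _
  map_add := by
    have h0 : PowerSeries.subst F.toPowerSeries (0 : PowerSeries R) = 0 := by
      rw [← PowerSeries.coe_substAlgHom (hasSubst_formalGroup F), map_zero]
    have hX : ∀ i : Fin 2, PowerSeries.subst (MvPowerSeries.X i : MvPowerSeries (Fin 2) R) (0 : PowerSeries R) = 0 :=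
      fun i => by rw [← PowerSeries.coe_substAlgHom (PowerSeries.HasSubst.X i), map_zero]
    rw [h0, hX 0, hX 1, G.add_zero PowerSeries.HasSubst.zero]

/-- The zero homomorphism is the series `0`. [cite: Hazewinkel1978, §1.2 Def. (1.2.1)] -/
@[simp] theorem zero_toPowerSeries : (FormalGroupHom.zero F G).toPowerSeries = 0 := rfl

/-- `ψ ∘ 0 = 0` (`ψ(0) = 0`). [cite: Hazewinkel1978, §1.2 Def. (1.2.1)] -/
theorem comp_zero (ψ : FormalGroupHom G H) : ψ.comp (FormalGroupHom.zero F G) = FormalGroupHom.zero F H := by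
  ext1
  simp only [comp_toPowerSeries, zero_toPowerSeries]
  rw [PowerSeries.subst_zero_of_constantCoeff_zero ψ.constantCoeff_eq_zero]

/-- `0 ∘ φ = 0`. [cite: Hazewinkel1978, §1.2 Def. (1.2.1)] -/
theorem zero_comp (φ : FormalGroupHom F G) : (FormalGroupHom.zero G H).comp φ = FormalGroupHom.zero F H := by
  ext1
  simp only [comp_toPowerSeries, zero_toPowerSeries]
  rw [← PowerSeries.coe_substAlgHom φ.hasSubst, map_zero]

/-! ## §2 Base change -/

/-- `map f` applied entrywise to a `2`-vector of series (private plumbing). [folklore] -/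
private theorem map_vec2 (f : R →+* S) {τ : Type*} (a b : MvPowerSeries τ R) :
    (fun i => MvPowerSeries.map f ((![a, b] : Fin 2 → MvPowerSeries τ R) i)) =
      ![MvPowerSeries.map f a, MvPowerSeries.map f b] := by
  funext i; fin_cases i <;> simp

/-- **Base change of a homomorphism** along `f : R →+* S`: `f_* φ : f_* F → f_* G` (apply `f` to the coefficients).
[cite: Hazewinkel1978, §1.1 (1.1.6)] -/
def map (f : R →+* S) (φ : FormalGroupHom F G) : FormalGroupHom (F.map f) (G.map f) where
  toPowerSeries := PowerSeries.map f φ.toPowerSeries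
  constantCoeff_eq_zero := by
    rw [← PowerSeries.coeff_zero_eq_constantCoeff_apply, PowerSeries.coeff_map,
      PowerSeries.coeff_zero_eq_constantCoeff_apply, φ.constantCoeff_eq_zero, map_zero]
  map_add := by
    have h := congrArg (MvPowerSeries.map f) φ.map_add
    rw [PowerSeries.map_subst (hasSubst_formalGroup F),
      MvPowerSeries.map_subst (hasSubst_pair (φ.hasSubst_subst (PowerSeries.HasSubst.X 0))
        (φ.hasSubst_subst (PowerSeries.HasSubst.X 1))), map_vec2,
      PowerSeries.map_subst (PowerSeries.HasSubst.X 0), PowerSeries.map_subst (PowerSeries.HasSubst.X 1),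
      MvPowerSeries.map_X, MvPowerSeries.map_X] at h
    simpa using h

/-- The series of the base-changed homomorphism is `f_* φ`. [cite: Hazewinkel1978, §1.1 (1.1.6)] -/
@[simp] theorem map_toPowerSeries (f : R →+* S) (φ : FormalGroupHom F G) :
    (φ.map f).toPowerSeries = PowerSeries.map f φ.toPowerSeries := rfl

/-- Base change of the identity is the identity. [cite: Hazewinkel1978, §1.1 (1.1.6)] -/
theorem map_id (f : R →+* S) : (FormalGroupHom.id F).map f = FormalGroupHom.id (F.map f) := by
  ext1; simp

/-- Base change commutes with composition: `f_*(ψ ∘ φ) = f_* ψ ∘ f_* φ`. [cite: Hazewinkel1978, §1.1 (1.1.6)] -/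
theorem map_comp (f : R →+* S) (ψ : FormalGroupHom G H) (φ : FormalGroupHom F G) :
    (ψ.comp φ).map f = (ψ.map f).comp (φ.map f) := by
  ext1
  simp only [map_toPowerSeries, comp_toPowerSeries]
  change MvPowerSeries.map f (PowerSeries.subst φ.toPowerSeries ψ.toPowerSeries) = _
  rw [PowerSeries.map_subst φ.hasSubst]
  rfl

/-! ## §3 The induced map on points -/

/-- A homomorphism `φ : F → G` acts on points with values in `MvPowerSeries σ R`: `x ↦ φ(x)`; it is additive for
Mathlib's `AddMonoid (F.Point σ)` (`x + y = F(x,y)`) by `map_add'`, and `φ(0) = 0`.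
[cite: Hazewinkel1978, §1.2 Def. (1.2.1)] -/
def pointMap (φ : FormalGroupHom F G) (σ : Type*) : F.Point σ →+ G.Point σ where
  toFun x := ⟨PowerSeries.subst x.val φ.toPowerSeries, φ.hasSubst_subst x.prop⟩
  map_zero' := Subtype.ext (by
    change PowerSeries.subst (0 : F.Point σ).val φ.toPowerSeries = (0 : G.Point σ).val
    rw [FormalGroup.zero_apply, FormalGroup.zero_apply,
      PowerSeries.subst_zero_of_constantCoeff_zero φ.constantCoeff_eq_zero])
  map_add' x y := Subtype.ext (by
    change PowerSeries.subst (x + y).val φ.toPowerSeries =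
      G.toPowerSeries.subst ![PowerSeries.subst x.val φ.toPowerSeries, PowerSeries.subst y.val φ.toPowerSeries]
    rw [FormalGroup.add_apply, φ.map_add' x.prop y.prop])

/-- The value of the induced map on points is `φ(x)`. [cite: Hazewinkel1978, §1.2 Def. (1.2.1)] -/
@[simp] theorem pointMap_apply_val (φ : FormalGroupHom F G) {σ : Type*} (x : F.Point σ) :
    (φ.pointMap σ x).val = PowerSeries.subst x.val φ.toPowerSeries := rfl

/-- The identity acts as the identity on points. [cite: Hazewinkel1978, §1.2 Def. (1.2.1)] -/
theorem pointMap_id {σ : Type*} (x : F.Point σ) : (FormalGroupHom.id F).pointMap σ x = x :=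
  Subtype.ext (by simp [PowerSeries.subst_X x.prop])

/-- Composites act by composition on points: `(ψ ∘ φ)(x) = ψ(φ(x))`. [cite: Hazewinkel1978, §1.2 Def. (1.2.1)] -/
theorem pointMap_comp (ψ : FormalGroupHom G H) (φ : FormalGroupHom F G) {σ : Type*} (x : F.Point σ) :
    (ψ.comp φ).pointMap σ x = ψ.pointMap σ (φ.pointMap σ x) :=
  Subtype.ext (by simp [PowerSeries.subst_comp_subst_apply φ.hasSubst x.prop])

end FormalGroupHom

end Literature.RingTheory.FormalGroups
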